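import Mathlib
import Summits.NavierStokesRegularity.NavierStokesRegularity.Theorems.ThreadingFluxAzimuthalCartanHalfSpaceCoords
import Summits.NavierStokesRegularity.NavierStokesRegularity.Theorems.ThreadingFluxAzimuthalCartanLocalCurlCurl
import HarnessLib

/-!
# Crux `PoloidalLiouville` (stmt-NavierStokesRegularity-1222, wall W1), crux idea «azimuthal-cartan-test» (ns-idea-15 g10):
# THE PLANAR-HARMONIC POTENTIAL FIELD `F = ∇((φ² − log²ρ)/2)` on the half-space

Support file (`--supports stmt-NavierStokesRegularity-1222`, helper; cell `ns-wall-extremal`, width hand ns-wall-eng-7 g7, 0 kit).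
The horizontal field common to the card's two explicit witnesses (the Poiseuille Jordan mode `jordanMode` of J♭ and `(2γ)⁻¹ •` the
horizontal part of the sectorial cross flow `crossFlow γ` of K♭):

  `F(y) = (φ/ρ²)(−y₁, y₀, 0) − (log ρ/ρ²)(y₀, y₁, 0)`,  `ρ² = y₀² + y₁²`, `φ = arctan (y₁/y₀)`,

written WITHOUT a new definition: the lemmas take a function `F` together with the hypothesis
`hF : F = fun y => c₀ y • e₀ + c₁ y • e₁` (the components spelled out; instantiate with `rfl`).  On `{y | 0 < y₀}`:

* `hasFDerivAt_potComp0` / `hasFDerivAt_potComp1` — the two components have the derivatives `(P dx₀ + Q dx₁)/ρ⁴`, `(Q dx₀ − P dx₁)/ρ⁴`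
  with `P = (y₀² − y₁²)(log ρ − 1) + 2y₀y₁φ`, `Q = 2y₀y₁(log ρ − 1) − (y₀² − y₁²)φ` (a symmetric trace-free matrix);
* `hasFDerivAt_pot`, `fderiv_pot_apply`, `divergence_pot` (`div F = 0`), `curl_pot` (`curl F = 0`), `analyticAt_pot`,
  `contDiffOn_pot_ball`, `laplacian_pot` (`ΔF = 0`, by the LOCAL `curl curl = ∇div − Δ` of `…LocalCurlCurl`, no second derivatives).

HONEST FRAME: calculus on an explicit field; closes no crux or sketch Prop; `PoloidalLiouville` (1222) and NS regularity OPEN.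
-/

-- the summit and its single sub-problem share the name (CONVENTIONS §1)
set_option linter.dupNamespace false

noncomputable section

namespace Summit.NavierStokesRegularity.NavierStokesRegularity.Theorems.PoloidalLiouville.AzimuthalCartan.HalfSpace

open Set Function Filter Topology Metric
open scoped ContDiff RealInnerProductSpace
open Literature.Analysis.FluidPDE
open Summit.NavierStokesRegularity.NavierStokesRegularity.Theorems.PoloidalLiouville.CentreJet (E3)
open Summit.NavierStokesRegularity.NavierStokesRegularity.Theorems.RotatingEulerWindowProfileLinearRung (hasFDerivAt_coord)

variable {x : E3}

/-! ### The two scalar components -/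

/-- **Derivative of the first component** `c₀ = (−φ y₁ − log ρ · y₀)/ρ²`:
`Dc₀ = (P dx₀ + Q dx₁)/ρ⁴`, `P = (y₀² − y₁²)(log ρ − 1) + 2y₀y₁φ`, `Q = 2y₀y₁(log ρ − 1) − (y₀² − y₁²)φ`. -/
theorem hasFDerivAt_potComp0 (hx : 0 < x 0) :
    HasFDerivAt (fun y : E3 => (-(azimuth y) * y 1 - Real.log (cylRadius y) * y 0) / cylRadius y ^ 2)
      (((x 0 ^ 2 + x 1 ^ 2) ^ 2)⁻¹ •
        (((x 0 ^ 2 - x 1 ^ 2) * (Real.log (cylRadius x) - 1) + 2 * x 0 * x 1 * azimuth x) • (EuclideanSpace.proj 0 : E3 →L[ℝ] ℝ) +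
          (2 * x 0 * x 1 * (Real.log (cylRadius x) - 1) - (x 0 ^ 2 - x 1 ^ 2) * azimuth x) • (EuclideanSpace.proj 1 : E3 →L[ℝ] ℝ)))
      x := by
  have hs := cylSq_pos hx
  have hN := (((hasFDerivAt_azimuth hx).neg).mul (hasFDerivAt_coord 1 x)).sub ((hasFDerivAt_logCyl hx).mul (hasFDerivAt_coord 0 x))
  have key := hasFDerivAt_div hN (hasFDerivAt_cylSq x) hs.ne'
  refine (key.congr_fderiv ?_).congr_of_eventuallyEq (Eventually.of_forall fun y => by
    simp only [cylRadius_sq, Pi.mul_apply, Pi.sub_apply, Pi.neg_apply])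
  ext v
  simp only [add_apply, sub_apply, neg_apply, smul_apply, smul_eq_mul, proj_apply', Pi.mul_apply, Pi.sub_apply, Pi.neg_apply]
  field_simp
  ring

/-- **Derivative of the second component** `c₁ = (φ y₀ − log ρ · y₁)/ρ²`: `Dc₁ = (Q dx₀ − P dx₁)/ρ⁴`. -/
theorem hasFDerivAt_potComp1 (hx : 0 < x 0) :
    HasFDerivAt (fun y : E3 => (azimuth y * y 0 - Real.log (cylRadius y) * y 1) / cylRadius y ^ 2)
      (((x 0 ^ 2 + x 1 ^ 2) ^ 2)⁻¹ •
        ((2 * x 0 * x 1 * (Real.log (cylRadius x) - 1) - (x 0 ^ 2 - x 1 ^ 2) * azimuth x) • (EuclideanSpace.proj 0 : E3 →L[ℝ] ℝ) -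
          ((x 0 ^ 2 - x 1 ^ 2) * (Real.log (cylRadius x) - 1) + 2 * x 0 * x 1 * azimuth x) • (EuclideanSpace.proj 1 : E3 →L[ℝ] ℝ)))
      x := by
  have hs := cylSq_pos hx
  have hN := ((hasFDerivAt_azimuth hx).mul (hasFDerivAt_coord 0 x)).sub ((hasFDerivAt_logCyl hx).mul (hasFDerivAt_coord 1 x))
  have key := hasFDerivAt_div hN (hasFDerivAt_cylSq x) hs.ne'
  refine (key.congr_fderiv ?_).congr_of_eventuallyEq (Eventually.of_forall fun y => by
    simp only [cylRadius_sq, Pi.mul_apply, Pi.sub_apply])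
  ext v
  simp only [add_apply, sub_apply, smul_apply, smul_eq_mul, proj_apply', Pi.mul_apply, Pi.sub_apply]
  field_simp
  ring

/-- The two components are analytic on the half-space. -/
theorem analyticAt_potComp0 (hx : 0 < x 0) :
    AnalyticAt ℝ (fun y : E3 => (-(azimuth y) * y 1 - Real.log (cylRadius y) * y 0) / cylRadius y ^ 2) x := by
  have h : AnalyticAt ℝ (fun y : E3 => (-(azimuth y) * y 1 - Real.log (cylRadius y) * y 0) / (y 0 ^ 2 + y 1 ^ 2)) x :=
    ((((analyticAt_azimuth hx).neg).mul (analyticAt_coord 1 x)).sub ((analyticAt_logCyl hx).mul (analyticAt_coord 0 x))).div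
      (analyticAt_cylSq x) (cylSq_pos hx).ne'
  exact h.congr (Eventually.of_forall fun y => by simp only [cylRadius_sq])

/-- The second component is analytic on the half-space. -/
theorem analyticAt_potComp1 (hx : 0 < x 0) :
    AnalyticAt ℝ (fun y : E3 => (azimuth y * y 0 - Real.log (cylRadius y) * y 1) / cylRadius y ^ 2) x := by
  have h : AnalyticAt ℝ (fun y : E3 => (azimuth y * y 0 - Real.log (cylRadius y) * y 1) / (y 0 ^ 2 + y 1 ^ 2)) x :=
    (((analyticAt_azimuth hx).mul (analyticAt_coord 0 x)).sub ((analyticAt_logCyl hx).mul (analyticAt_coord 1 x))).div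
      (analyticAt_cylSq x) (cylSq_pos hx).ne'
  exact h.congr (Eventually.of_forall fun y => by simp only [cylRadius_sq])

/-- A ball about a point of the half-space of radius its first coordinate stays in the half-space. -/
theorem apply_zero_pos_of_mem_ball_self {y : E3} (hy : y ∈ ball x (x 0)) : 0 < y 0 := by
  rw [mem_ball, dist_eq_norm] at hy
  have h1 : |(y - x) 0| ≤ ‖y - x‖ := by
    have := PiLp.norm_apply_le (p := 2) (y - x) 0
    simpa using this
  have h2 : (y - x) 0 = y 0 - x 0 := by simp
  rw [h2] at h1
  have h3 : |y 0 - x 0| < x 0 := lt_of_le_of_lt h1 hy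
  rw [abs_lt] at h3
  linarith

/-! ### The field `F = c₀ e₀ + c₁ e₁` -/

section Field

variable {F : E3 → E3}
  (hF : F = fun y : E3 =>
    ((-(azimuth y) * y 1 - Real.log (cylRadius y) * y 0) / cylRadius y ^ 2) • (EuclideanSpace.single 0 (1 : ℝ) : E3) +
    ((azimuth y * y 0 - Real.log (cylRadius y) * y 1) / cylRadius y ^ 2) • (EuclideanSpace.single 1 (1 : ℝ) : E3))

include hF

/-- **The derivative of `F`.** -/
theorem hasFDerivAt_pot (hx : 0 < x 0) :
    HasFDerivAt F
      ((((x 0 ^ 2 + x 1 ^ 2) ^ 2)⁻¹ •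
        (((x 0 ^ 2 - x 1 ^ 2) * (Real.log (cylRadius x) - 1) + 2 * x 0 * x 1 * azimuth x) • (EuclideanSpace.proj 0 : E3 →L[ℝ] ℝ) +
          (2 * x 0 * x 1 * (Real.log (cylRadius x) - 1) - (x 0 ^ 2 - x 1 ^ 2) * azimuth x) •
            (EuclideanSpace.proj 1 : E3 →L[ℝ] ℝ))).smulRight (EuclideanSpace.single 0 (1 : ℝ) : E3) +
       (((x 0 ^ 2 + x 1 ^ 2) ^ 2)⁻¹ •
        ((2 * x 0 * x 1 * (Real.log (cylRadius x) - 1) - (x 0 ^ 2 - x 1 ^ 2) * azimuth x) • (EuclideanSpace.proj 0 : E3 →L[ℝ] ℝ) -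
          ((x 0 ^ 2 - x 1 ^ 2) * (Real.log (cylRadius x) - 1) + 2 * x 0 * x 1 * azimuth x) •
            (EuclideanSpace.proj 1 : E3 →L[ℝ] ℝ))).smulRight (EuclideanSpace.single 1 (1 : ℝ) : E3))
      x := by
  subst hF
  exact ((hasFDerivAt_potComp0 hx).smul_const _).add ((hasFDerivAt_potComp1 hx).smul_const _)

/-- **Evaluation of `DF(x) v` in coordinates.** With `s = x₀² + x₁²`, `P`, `Q` as above:
`DF(x) v = s⁻² ((P v₀ + Q v₁) e₀ + (Q v₀ − P v₁) e₁)`. -/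
theorem fderiv_pot_apply (hx : 0 < x 0) (v : E3) :
    fderiv ℝ F x v =
      (((x 0 ^ 2 + x 1 ^ 2) ^ 2)⁻¹ *
        (((x 0 ^ 2 - x 1 ^ 2) * (Real.log (cylRadius x) - 1) + 2 * x 0 * x 1 * azimuth x) * v 0 +
          (2 * x 0 * x 1 * (Real.log (cylRadius x) - 1) - (x 0 ^ 2 - x 1 ^ 2) * azimuth x) * v 1)) •
          (EuclideanSpace.single 0 (1 : ℝ) : E3) +
      (((x 0 ^ 2 + x 1 ^ 2) ^ 2)⁻¹ *
        ((2 * x 0 * x 1 * (Real.log (cylRadius x) - 1) - (x 0 ^ 2 - x 1 ^ 2) * azimuth x) * v 0 -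
          ((x 0 ^ 2 - x 1 ^ 2) * (Real.log (cylRadius x) - 1) + 2 * x 0 * x 1 * azimuth x) * v 1)) •
          (EuclideanSpace.single 1 (1 : ℝ) : E3) := by
  rw [(hasFDerivAt_pot hF hx).fderiv]
  simp only [add_apply, sub_apply, smul_apply, ContinuousLinearMap.smulRight_apply, smul_eq_mul, proj_apply']

/-- Coordinates of `DF(x) v`. -/
theorem fderiv_pot_apply_zero (hx : 0 < x 0) (v : E3) :
    fderiv ℝ F x v 0 = ((x 0 ^ 2 + x 1 ^ 2) ^ 2)⁻¹ *
        (((x 0 ^ 2 - x 1 ^ 2) * (Real.log (cylRadius x) - 1) + 2 * x 0 * x 1 * azimuth x) * v 0 +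
          (2 * x 0 * x 1 * (Real.log (cylRadius x) - 1) - (x 0 ^ 2 - x 1 ^ 2) * azimuth x) * v 1) := by
  rw [fderiv_pot_apply hF hx v]
  simp

/-- Second coordinate of `DF(x) v`. -/
theorem fderiv_pot_apply_one (hx : 0 < x 0) (v : E3) :
    fderiv ℝ F x v 1 = ((x 0 ^ 2 + x 1 ^ 2) ^ 2)⁻¹ *
        ((2 * x 0 * x 1 * (Real.log (cylRadius x) - 1) - (x 0 ^ 2 - x 1 ^ 2) * azimuth x) * v 0 -
          ((x 0 ^ 2 - x 1 ^ 2) * (Real.log (cylRadius x) - 1) + 2 * x 0 * x 1 * azimuth x) * v 1) := by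
  rw [fderiv_pot_apply hF hx v]
  simp

/-- Third coordinate of `DF(x) v` (zero: `F` is horizontal and `z`-independent). -/
theorem fderiv_pot_apply_two (hx : 0 < x 0) (v : E3) : fderiv ℝ F x v 2 = 0 := by
  rw [fderiv_pot_apply hF hx v]
  simp

/-- **`div F = 0`** (the matrix is trace free). -/
theorem divergence_pot (hx : 0 < x 0) : VectorCalculus.divergence F x = 0 := by
  rw [divergence_eq_sum_inner_fderiv (EuclideanSpace.basisFun (Fin 3) ℝ)]
  simp only [Fin.sum_univ_three, EuclideanSpace.basisFun_apply, EuclideanSpace.inner_single_left, map_one, one_mul]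
  rw [fderiv_pot_apply_zero hF hx, fderiv_pot_apply_one hF hx, fderiv_pot_apply_two hF hx]
  simp
  ring

/-- **`curl F = 0`** (the matrix is symmetric). -/
theorem curl_pot (hx : 0 < x 0) : curl F x = 0 := by
  have h0 := fun v => fderiv_pot_apply_zero hF hx v
  have h1 := fun v => fderiv_pot_apply_one hF hx v
  have h2 := fun v => fderiv_pot_apply_two hF hx v
  ext i
  fin_cases i <;> simp [curl, h0, h1, h2]

/-- `F` is analytic on the half-space. -/
theorem analyticAt_pot (hx : 0 < x 0) : AnalyticAt ℝ F x := by
  subst hF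
  exact ((analyticAt_potComp0 hx).smul analyticAt_const).add ((analyticAt_potComp1 hx).smul analyticAt_const)

/-- `F` is `C²` on such a ball. -/
theorem contDiffOn_pot_ball : ContDiffOn ℝ 2 F (ball x (x 0)) := fun _ hy =>
  ((analyticAt_pot hF (apply_zero_pos_of_mem_ball_self hy)).contDiffAt (n := 2)).contDiffWithinAt

/-- **`ΔF = 0`** on the half-space (harmonic gradient: `div F = 0`, `curl F = 0` near `x`). -/
theorem laplacian_pot (hx : 0 < x 0) : Laplacian.laplacian F x = 0 :=
  LocalCurlCurl.laplacian_eq_zero_of_div_curl_local hx (contDiffOn_pot_ball hF)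
    (fun _ hy => divergence_pot hF (apply_zero_pos_of_mem_ball_self hy))
    (fun _ hy => curl_pot hF (apply_zero_pos_of_mem_ball_self hy))

end Field

end Summit.NavierStokesRegularity.NavierStokesRegularity.Theorems.PoloidalLiouville.AzimuthalCartan.HalfSpace

end
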